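import Summits.BirchSwinnertonDyer.Rank1Residual.X11b.WeakLeopoldt
import Summits.BirchSwinnertonDyer.Rank1Residual.GaloisImage.LocalEulerPoincareCharacteristicHolds
import Summits.BirchSwinnertonDyer.BirchSwinnertonDyer.Theorems.ByReductionTypeAtTwoSupersingularTowerTorsionTwo
import Literature.NumberTheory.EllipticCurves.IwasawaSelmerControlLocalizationProofs
import HarnessLib

/-!
# `res : H²(Γ_ℚ, E[2^∞]) → H²(Gal(ℚ̄/ℚ_∞), E[2^∞])` is injective as soon as `Ш²(ℚ, E[2^∞]) = 0` — the real place lies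
# BELOW `ℚ_∞`, and `H²(ℚ_v, E[2^∞]) = 0` at every finite `v` (K4 Prop-4.12 elimination lane, part 3)

Route `ThetaPartnerAtTwo` (TP2; crux shared with `ResidualThetaTransportAtTwo`), crux K4 `SignedControlAtTwo`
(stmt-BirchSwinnertonDyer-20309), line `eulerchar` v10. Seat `prover-bsd-wall-tp2-p3-w2` (width seat 2/3, gen 5).

Part 2 (`…CoinvOfResTwo`) reduced COINV⁺@2 / EC2 / both conjuncts of K4 for every curve of the row to CASSELS and the
displayed `H²` statement `hres`: every `c ∈ H²(Γ_ℚ, E[2^∞])` with `res_{Gal(ℚ̄/ℚ_∞)} c = 0` is `0`. Here `hres` is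
reduced to the vanishing of the SECOND TATE–SHAFAREVICH GROUP `Ш²(ℚ, E[2^∞]) = ⋂_v ker loc_v`
(`DiscreteGaloisModule.shaTwo`, all places): a class killed by `res_{Gal(ℚ̄/ℚ_∞)}` is locally trivial
* at every INFINITE place `w`, because `Γ_{ℚ_w}` (finite) maps into `Gal(ℚ̄/ℚ_∞) = ker κ` (`ℤ₂` is torsion-free:
  `ZpExtension.resGal_infinitePlace_mem_kerSubgroup` — "archimedean places split completely in `ℚ_∞/ℚ`"), so `loc_w`
  FACTORS through `res_{ker κ}` (§1, any number field, any `ℤ_p`-extension, any discrete module, cocycle level);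
* at every FINITE place, because `H²(ℚ_v, E[2^∞]) = 0`: at `v ∤ 2` this is X11b's `galoisCohomology_two_primary_eq_zero`
  (local duality `(2,0)` + Lutz–Mattuck, with the PROVED `localEulerPoincareCharacteristic_holds`); at `v ∣ 2` (§2)
  the same transition-map argument through `cd₂(Γ_{ℚ₂}) ≤ 2` (`Levels.map_two_torsionInclusion_eq_zero_of_exponent`)
  fed with «`E(ℚ₂)` has no `2`-torsion» at a good supersingular `2` (Sprung 2012 Lemma 2.3 at `2`, tree theorem
  `two_nsmul_eq_zero_padic_of_goodSS_two`).
So (§3) **`Ш²(ℚ, E[2^∞]) = 0 ⟹ hres`** for every globally minimal `W/ℚ` with `GoodSS W 2` and EVERY `ℤ₂`-extension `κ`.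
Part 4 proves `Ш²(ℚ, E[2^∞]) = 0` on the row from finite-level Poitou–Tate.

HONEST FRAMING: THEOREMS ONLY (no definition, no named fact, no `sorry`), route-independent; credit X11b (sub-cell
b2b-bsdres-multr1-p1) for the local `H²` machinery; nothing about any curve is asserted beyond the displayed hypotheses;
closes no item by itself; BSD is not proved by any of this.

References: [JetchevSkinnerWan2017] Lemma 3.3.3 and §2.2.2 (arXiv:1512.06894 pp. 6, 11–12); [GreenbergLNM1716] §3 p. 86
(archimedean places split), §4 p. 119; [Sprung2012] Lemma 2.3; [MilneADT2006] I Cor. 2.3, Thm. 2.8; [SerreGaloisCohomology1997]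
I §2.3–2.4, II §4.3.
-/

set_option autoImplicit false
-- the Theorems namespace of this sub repeats the summit name by design (D-0017 nested layout)
set_option linter.dupNamespace false

noncomputable section

open scoped Classical NumberField

open CategoryTheory NumberField IsDedekindDomain Field
open Literature.NumberTheory.EllipticCurves Literature.NumberTheory.GaloisRepresentations
open Literature.NumberTheory.GaloisRepresentations.DiscreteGaloisModule (shaTwo mem_shaTwo_iff)

namespace Summit.BirchSwinnertonDyer.BirchSwinnertonDyer.Theorems.SignedEC.ResTwo

/-! ## §1 The infinite places lie below `K_∞`: `loc_w` factors through `res_{Gal(K̄/K_∞)}` -/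

section Infinite

variable {K : Type} [Field K] [NumberField K] {M : Type} [AddCommGroup M] [TopologicalSpace M]
  [DiscreteTopology M] (ρ : DiscreteGaloisModule K M) {p : ℕ} [Fact p.Prime] (κ : ZpExtension K p)

/-- **`res_{Gal(K̄/K_∞)} c = 0 ⟹ loc_w c = 0` at every infinite place `w`** of the number field `K`, for every
`ℤ_p`-extension `κ` and every discrete `Γ_K`-module: `Γ_{K_w} → Γ_K` lands in `ker κ`
(`ZpExtension.resGal_infinitePlace_mem_kerSubgroup`: `Γ_{K_w}` is finite, `ℤ_p` torsion-free — Greenberg §3 p. 86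
"archimedean primes split completely in `F_∞/F`"), and a `2`-cocycle that is a coboundary `∂b` on `ker κ` pulls back
to the coboundary `∂(b ∘ res_w)`. [cite: GreenbergLNM1716, §3 p. 86] [cite: SerreGaloisCohomology1997, I §2.3–2.4] -/
theorem localization_inl_two_eq_zero_of_resSubgroup_kerSubgroup_eq_zero (w : InfinitePlace K)
    (c : galoisCohomology ρ 2) (hc : resSubgroup ρ.toTopRep κ.kerSubgroup 2 c = 0) :
    galoisCohomology.localization ρ (Sum.inl w) 2 c = 0 := by
  -- `H²` on explicit cocycles needs `LocallyCompactSpace Γ` (compactness of absolute Galois groups)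
  haveI : CompactSpace (absoluteGaloisGroup K) := absoluteGaloisGroup_compactSpace K
  haveI : CompactSpace (absoluteGaloisGroup (Place.Completion (Sum.inl w : Place K))) :=
    absoluteGaloisGroup_compactSpace _
  obtain ⟨f, rfl⟩ := twoCocycleClass_surjective _ c
  -- localisation on `2`-cocycles at the infinite place: `loc_w [f] = [f ∘ (res_w × res_w)]`
  have key : galoisCohomology.localization ρ (Sum.inl w) 2 (twoCocycleClass ρ.toTopRep f) =
      twoCocycleClass (DiscreteGaloisModule.toTopRep (ρ.toLocal (Sum.inl w)))
        (contTwoCocycles.pullback (absGaloisRestrict K w.Completion) (X := ρ.toTopRep)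
          (Y := DiscreteGaloisModule.toTopRep (ρ.toLocal (Sum.inl w)))
          (TopRep.ofHom ⟨ContinuousLinearMap.id ℤ M, fun _ => rfl⟩) f) :=
    map_twoCocycleClass _ _ _ f
  -- on `ker κ` the cocycle is a coboundary `∂b`
  rw [resSubgroup, map_twoCocycleClass, twoCocycleClass_eq_zero_iff] at hc
  obtain ⟨b, hb⟩ := hc
  -- `res_w` lands in `ker κ`
  have hmem : ∀ τ : absoluteGaloisGroup w.Completion, absGaloisRestrict K w.Completion τ ∈ κ.kerSubgroup :=
    fun τ ↦ ZpExtension.resGal_infinitePlace_mem_kerSubgroup κ w τ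
  let r : C(absoluteGaloisGroup w.Completion, κ.kerSubgroup) :=
    ⟨fun τ ↦ ⟨absGaloisRestrict K w.Completion τ, hmem τ⟩,
      (absGaloisRestrict K w.Completion).continuous.subtype_mk _⟩
  rw [key]
  refine (twoCocycleClass_eq_zero_iff _ _).mpr ⟨b.comp r, fun σ τ ↦ ?_⟩
  have h := hb (r σ) (r τ)
  rw [contTwoCocycles.pullback_apply] at h ⊢
  have e : r σ * r τ = r (σ * τ) := Subtype.ext (map_mul (absGaloisRestrict K w.Completion) σ τ).symm
  rw [e] at h
  exact h

end Infinite

/-! ## §2 `H²(K_v, E[p^∞]) = 0` at a place `v ∣ p` where `E(K_v)` has bounded `p`-power torsion -/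

section AboveP

variable {K : Type} [Field K] [NumberField K] (W : WeierstrassCurve K) [W.IsElliptic] (p : ℕ) [Fact p.Prime]
  (v : HeightOneSpectrum (𝓞 K))

/-- **`H²(K_v, E[p^∞]) = 0` at ANY finite place with a uniform `p`-power torsion exponent for `E(K_v)`** (also
`v ∣ p`): a class comes from some `H²(K_v, E[p^N])` (`Levels.exists_map_two_primaryInclusion_eq`), and the transition
`H²(K_v, E[p^N]) → H²(K_v, E[p^N·p^b])` (`b = e + 1`) vanishes (`Levels.map_two_torsionInclusion_eq_zero_of_exponent`,
through `cd_p(Γ_{K_v}) ≤ 2` and local duality `(2,0)` — JSW17 "`H²(K_w, W)` is dual to `H⁰(K_w, T) = 0`").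
[cite: JetchevSkinnerWan2017, §2.2.2 and Lemma 3.3.3 (arXiv:1512.06894 pp. 6, 12)] [cite: SerreGaloisCohomology1997, II §4.3 Prop. 12] -/
theorem galoisCohomology_two_primary_eq_zero_of_exponent {e : ℕ}
    (he : ∀ (j : ℕ) (Q : (W.baseChange (v.adicCompletion K)).toAffine.Point), p ^ j • Q = 0 → p ^ e • Q = 0)
    (Z : galoisCohomology (GaloisRep.restrictField (v.adicCompletion K)
      (Summit.BirchSwinnertonDyer.Rank1Residual.X11b.LocBridge.primaryGaloisModule W p)) 2) : Z = 0 := by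
  haveI : CharZero (v.adicCompletion K) :=
    charZero_of_injective_algebraMap (algebraMap K (v.adicCompletion K)).injective
  obtain ⟨N₀, z₀, rfl⟩ :=
    Summit.BirchSwinnertonDyer.Rank1Residual.X11b.Levels.exists_map_two_primaryInclusion_eq W p (v.adicCompletion K) Z
  -- move to a level `N = N₀ + 1 ≥ 1`
  set N := N₀ + 1 with hN
  have hN0 : N ≠ 0 := Nat.succ_ne_zero _
  have h0N : ((p ^ N₀ : ℕ) : ℤ) ∣ ((p ^ N : ℕ) : ℤ) := Int.natCast_dvd_natCast.mpr (Nat.pow_dvd_pow p (by omega))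
  set z := galoisCohomology.map ((W.torsionInclusion h0N).restrictField (v.adicCompletion K)) 2 z₀ with hz
  have h1 : galoisCohomology.map
      ((Summit.BirchSwinnertonDyer.Rank1Residual.X11b.Levels.primaryInclusion W p N₀).restrictField
        (v.adicCompletion K)) 2 z₀ =
      galoisCohomology.map
        ((Summit.BirchSwinnertonDyer.Rank1Residual.X11b.Levels.primaryInclusion W p N).restrictField
          (v.adicCompletion K)) 2 z :=
    (Summit.BirchSwinnertonDyer.Rank1Residual.X11b.Levels.map_two_map_two_eq_map_two
      (ρ₁ := GaloisRep.restrictField (v.adicCompletion K) (W.torsionGaloisModule ((p ^ N₀ : ℕ) : ℤ)))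
      (ρ₂ := GaloisRep.restrictField (v.adicCompletion K) (W.torsionGaloisModule ((p ^ N : ℕ) : ℤ)))
      (ρ₃ := GaloisRep.restrictField (v.adicCompletion K)
        (Summit.BirchSwinnertonDyer.Rank1Residual.X11b.LocBridge.primaryGaloisModule W p))
      _ _ _ (fun Q ↦ Subtype.ext rfl) z₀).symm
  rw [h1]
  -- the transition `E[p^N] ↪ E[p^N · p^b]`, `b = e + 1`, kills `z`; factor `ι_N` through it
  set b := e + 1 with hb
  have hab : ((p ^ N : ℕ) : ℤ) * ((p ^ b : ℕ) : ℤ) ∣ ((p ^ (N + b) : ℕ) : ℤ) :=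
    ⟨1, by rw [mul_one, ← Nat.cast_mul, ← pow_add]⟩
  set T₁ := (W.torsionInclusion (Dvd.intro ((p ^ b : ℕ) : ℤ) rfl :
    ((p ^ N : ℕ) : ℤ) ∣ ((p ^ N : ℕ) : ℤ) * ((p ^ b : ℕ) : ℤ))).restrictField (v.adicCompletion K) with hT₁
  set T₂ := (W.torsionInclusion hab).restrictField (v.adicCompletion K) with hT₂
  have h2 : galoisCohomology.map
      ((Summit.BirchSwinnertonDyer.Rank1Residual.X11b.Levels.primaryInclusion W p N).restrictField
        (v.adicCompletion K)) 2 z =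
      galoisCohomology.map
        ((Summit.BirchSwinnertonDyer.Rank1Residual.X11b.Levels.primaryInclusion W p (N + b)).restrictField
          (v.adicCompletion K)) 2 (galoisCohomology.map T₂ 2 (galoisCohomology.map T₁ 2 z)) := by
    rw [Summit.BirchSwinnertonDyer.Rank1Residual.X11b.Levels.map_two_map_two_eq_map_two
      (ρ₁ := GaloisRep.restrictField (v.adicCompletion K) (W.torsionGaloisModule ((p ^ N : ℕ) : ℤ)))
      (ρ₂ := GaloisRep.restrictField (v.adicCompletion K)
        (W.torsionGaloisModule (((p ^ N : ℕ) : ℤ) * ((p ^ b : ℕ) : ℤ))))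
      (ρ₃ := GaloisRep.restrictField (v.adicCompletion K) (W.torsionGaloisModule ((p ^ (N + b) : ℕ) : ℤ)))
      T₁ T₂ ((W.torsionInclusion (dvd_trans (Dvd.intro _ rfl) hab)).restrictField (v.adicCompletion K))
      (fun Q ↦ Subtype.ext rfl) z]
    exact (Summit.BirchSwinnertonDyer.Rank1Residual.X11b.Levels.map_two_map_two_eq_map_two
      (ρ₁ := GaloisRep.restrictField (v.adicCompletion K) (W.torsionGaloisModule ((p ^ N : ℕ) : ℤ)))
      (ρ₂ := GaloisRep.restrictField (v.adicCompletion K) (W.torsionGaloisModule ((p ^ (N + b) : ℕ) : ℤ)))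
      (ρ₃ := GaloisRep.restrictField (v.adicCompletion K)
        (Summit.BirchSwinnertonDyer.Rank1Residual.X11b.LocBridge.primaryGaloisModule W p))
      _ _ _ (fun Q ↦ Subtype.ext rfl) z).symm
  rw [h2, hT₁, Summit.BirchSwinnertonDyer.Rank1Residual.X11b.Levels.map_two_torsionInclusion_eq_zero_of_exponent W p
    (v.adicCompletion K) hN0 (Nat.succ_ne_zero e) (Nat.le_succ e) he z, map_zero, map_zero]

end AboveP

/-! ## §3 Over `ℚ` at a good supersingular `2`: `Ш²(ℚ, E[2^∞]) = 0 ⟹ hres` -/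

section Rat

variable (W : WeierstrassCurve ℚ) [W.IsElliptic] [W.IsGloballyMinimal] (κ : ZpExtension ℚ 2)

omit [W.IsElliptic] in
/-- **No `2`-power torsion in `E(ℚ₂)` at a good supersingular `2`**, as a uniform exponent `e = 0` for the transition
argument of §2 (Sprung 2012 Lemma 2.3 at `p = 2`: tree `two_nsmul_eq_zero_padic_of_goodSS_two`, transported to
`ℚ_v = v.adicCompletion ℚ`). [cite: Sprung2012, Lemma 2.3 (p. 1487)] -/
theorem pow_smul_eq_zero_exponent_zero_of_goodSS (hss : Literature.NumberTheory.EllipticCurves.Rank1Residual.GoodSS W 2) (v : HeightOneSpectrum (𝓞 ℚ))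
    (hv : (2 : 𝓞 ℚ) ∈ v.asIdeal) (j : ℕ) (Q : (W.baseChange (v.adicCompletion ℚ)).toAffine.Point)
    (hQ : 2 ^ j • Q = 0) : 2 ^ 0 • Q = 0 := by
  have hv0 : ∀ Q : (W.baseChange (v.adicCompletion ℚ)).toAffine.Point, 2 • Q = 0 → Q = 0 :=
    (W.forall_nsmul_eq_zero_adicCompletion_iff_padic (p := 2) (by exact_mod_cast hv) 2).mpr
      (SSFlatEC.two_nsmul_eq_zero_padic_of_goodSS_two W hss)
  rw [pow_zero, one_smul]
  induction j generalizing Q with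
  | zero => simpa using hQ
  | succ j ih =>
    apply ih
    apply hv0
    rw [smul_smul, ← pow_succ']
    exact hQ

/-- **`Ш²(ℚ, E[2^∞]) = 0 ⟹ hres`** (globally minimal or not: any `W/ℚ` elliptic with `GoodSS W 2`; ANY `ℤ₂`-extension
`κ`): if every everywhere-locally-trivial class of `H²(Γ_ℚ, E[2^∞])` vanishes, then every class with
`res_{Gal(ℚ̄/ℚ_∞)} c = 0` vanishes — it is locally trivial at `∞` by §1 and at every finite place because
`H²(ℚ_v, E[2^∞]) = 0` (X11b at `v ∤ 2` with the proved local Euler–Poincaré characteristic; §2 at `v ∣ 2`).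
This is the `hres` input of `SignedEC.ResTwo.signedControl_two_allCurves_of_cassels_of_resTwo` (part 2).
[cite: JetchevSkinnerWan2017, Lemma 3.3.3 (arXiv:1512.06894 p. 12)] [cite: GreenbergLNM1716, §3 p. 86, §4 p. 119] -/
theorem resTwo_injective_of_shaTwo (hss : Literature.NumberTheory.EllipticCurves.Rank1Residual.GoodSS W 2)
    (hsha : ∀ c ∈ shaTwo (Summit.BirchSwinnertonDyer.Rank1Residual.X11b.LocBridge.primaryGaloisModule W 2), c = 0)
    (c : galoisCohomology (Summit.BirchSwinnertonDyer.Rank1Residual.X11b.LocBridge.primaryGaloisModule W 2) 2)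
    (hc : resSubgroup (Summit.BirchSwinnertonDyer.Rank1Residual.X11b.LocBridge.primaryGaloisModule W 2).toTopRep
      κ.kerSubgroup 2 c = 0) : c = 0 := by
  refine hsha c ((mem_shaTwo_iff _ c).mpr ?_)
  rintro (w | v)
  · exact localization_inl_two_eq_zero_of_resSubgroup_kerSubgroup_eq_zero _ κ w c hc
  · by_cases hv : (2 : 𝓞 ℚ) ∈ v.asIdeal
    · exact galoisCohomology_two_primary_eq_zero_of_exponent W 2 v (pow_smul_eq_zero_exponent_zero_of_goodSS W hss v hv) _
    · haveI : CharZero (v.adicCompletion ℚ) :=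
        charZero_of_injective_algebraMap (algebraMap ℚ (v.adicCompletion ℚ)).injective
      exact Summit.BirchSwinnertonDyer.Rank1Residual.X11b.Levels.galoisCohomology_two_primary_eq_zero W 2 v
        (localEulerPoincareCharacteristic_holds (v.adicCompletion ℚ)) hv _

end Rat

end Summit.BirchSwinnertonDyer.BirchSwinnertonDyer.Theorems.SignedEC.ResTwo

end
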